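import Literature.Analysis.FunctionSpaces.PolchinskiEntropyDerivativeSmoothed
import Mathlib.Analysis.Convex.Integral
import HarnessLib

/-!
# Auxiliary estimates for the exchange inequality in the smoothed class
# (Bauerschmidt–Bodineau–Dagallier, proof of Theorem 3, when `V₀` is unbounded above)

Topic `Literature/Analysis/FunctionSpaces`; "proof architecture" file behind the named fact
`Polchinski.BauerschmidtBodineau_multiscaleBakryEmery` ([BBD] Theorem 3, `MultiscaleBakryEmery.lean`).

This file collects the three self-contained inputs of the smoothed-class exchange inequality
(`PolchinskiExchangeSmoothed.lean`, in preparation): (i) `Ψ`-domination of third partials,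
(ii) a Gaussian lower bound `E_{C_s}[Ψ(y+·)] ≥ m e^{−2c₂‖y‖²}` UNIFORM in the scale `s` near `t`
(Jensen + Fernique), and (iii) the per-pair master bound for the tempered slope of
`Z·Ċ^{kl}m_km_l/u` — the exact second-order identity `q_s − q_t − h q̇ = S_Zθ_t + Z_sR₂ + Dθ_t·r` of the
`1`-homogeneous map `(u, z, w) ↦ (w−uz)_k(w−uz)_l/u` and elementary bounds, with the normalized
increments `δu, δz, δm` kept as free parameters `D_u, D_z, D_m` (so that the same bound serves where
`Z_t(y)` is large — `D ∝ |h|` — and where it is small — `D` tame).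

## Main results (sorry-free; no new definitions, no new named facts)

* `dominated_partial₃`, `eventually_mul_exp_neg_le_atom`, `sqrtEnergy_pair_bound`.

Nothing here concerns Yang–Mills (R4 = `BalabanLadder.UV` only).

## References

* [BauerschmidtBodineauDagallier2023] R. Bauerschmidt, T. Bodineau, B. Dagallier, Probab. Surveys 21
  (2024) 200–290, arXiv:2307.07619 — Theorem 3 proof p0016 L47–153, Lemma 1 p0016–p0017, Prop 5 p0014.
  READ (held text `paper:arxiv-2307.07619`).
* [DapratoZabczyk1992] G. Da Prato, J. Zabczyk, Stochastic Equations in Infinite Dimensions — Thm 2.7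
  (Fernique; Gaussian exponential moments).
-/

noncomputable section

-- nested operator-norm instances `E →L[ℝ] E →L[ℝ] E →L[ℝ] ℝ`
set_option maxSynthPendingDepth 4

open MeasureTheory ProbabilityTheory Filter Topology Set
open scoped RealInnerProductSpace Matrix MatrixOrder

namespace Literature.Analysis.FunctionSpaces

namespace Polchinski

variable {N : ℕ}

/-! ### Helpers -/

section Helpers

/-- A bounded continuous shift `ζ ↦ H(y+ζ)` is integrable for a finite measure. [folklore] -/
private theorem integrable_shift'' {Y : Type*} [NormedAddCommGroup Y] {H : EuclideanSpace ℝ (Fin N) → Y}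
    (hHc : Continuous H) {MH : ℝ} (hH : ∀ x, ‖H x‖ ≤ MH) (P : Measure (EuclideanSpace ℝ (Fin N)))
    [IsFiniteMeasure P] (y : EuclideanSpace ℝ (Fin N)) : Integrable (fun ζ => H (y + ζ)) P :=
  Integrable.of_bound (hHc.comp (continuous_const.add continuous_id)).aestronglyMeasurable MH
    (Eventually.of_forall fun ζ => hH (y + ζ))

/-- `Ψ`-domination of the third partials `x ↦ D³G(x)(v, w, w′)` (as partials of partials).
[cite: Rudin1976, Thm 9.19] -/
theorem dominated_partial₃ {Ψ G : EuclideanSpace ℝ (Fin N) → ℝ} {BG : ℝ} {M : ℕ} (hM : 1 ≤ M)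
    (hG : ContDiff ℝ ((M + 3 : ℕ) : WithTop ℕ∞) G)
    (hBG : ∀ n ≤ M + 3, ∀ x, ‖iteratedFDeriv ℝ n G x‖ ≤ BG)
    (hwG : ∀ n ≤ M + 3, ∀ δ : ℝ, 0 < δ → ∃ c : ℝ, 0 ≤ c ∧
      ∀ (P : Measure (EuclideanSpace ℝ (Fin N))) [IsProbabilityMeasure P] (y : EuclideanSpace ℝ (Fin N)),
        ∫ ζ, ‖iteratedFDeriv ℝ n G (y + ζ)‖ ∂P ≤ c * (∫ ζ, Ψ (y + ζ) ∂P) ^ (1 - δ))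
    (v w w' : EuclideanSpace ℝ (Fin N)) :
    ContDiff ℝ M (fun x => fderiv ℝ (fderiv ℝ (fderiv ℝ G)) x v w w') ∧
    (∀ n ≤ M, ∀ x, ‖iteratedFDeriv ℝ n (fun x => fderiv ℝ (fderiv ℝ (fderiv ℝ G)) x v w w') x‖ ≤
      ‖w'‖ * (‖w‖ * (‖v‖ * BG))) ∧
    (∀ n ≤ M, ∀ δ : ℝ, 0 < δ → ∃ c : ℝ, 0 ≤ c ∧
      ∀ (P : Measure (EuclideanSpace ℝ (Fin N))) [IsProbabilityMeasure P] (y : EuclideanSpace ℝ (Fin N)),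
        ∫ ζ, ‖iteratedFDeriv ℝ n (fun x => fderiv ℝ (fderiv ℝ (fderiv ℝ G)) x v w w') (y + ζ)‖ ∂P ≤
          c * (∫ ζ, Ψ (y + ζ) ∂P) ^ (1 - δ)) := by
  have h2 := dominated_partial₂ (M := M + 1) (by omega) (Ψ := Ψ) hG hBG hwG v w
  have h3 := dominated_partial (M := M) (Ψ := Ψ) h2.1 h2.2.1 h2.2.2 w'
  have hG4 : ContDiff ℝ 4 G := hG.of_le (by exact_mod_cast (by omega : 4 ≤ M + 3))
  have he : (fun x => fderiv ℝ (fun x => fderiv ℝ (fderiv ℝ G) x v w) x w') =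
      fun x => fderiv ℝ (fderiv ℝ (fderiv ℝ G)) x v w w' := by
    funext x
    have hin : HasFDerivAt (fun x => fderiv ℝ (fderiv ℝ G) x v w)
        ((ContinuousLinearMap.apply ℝ ℝ w).comp (fderiv ℝ (fderiv ℝ (fderiv ℝ G)) x v)) x := by
      have h := (ContinuousLinearMap.apply ℝ ℝ w).hasFDerivAt.comp x
        (Cb4.hasFDerivAt_fderiv_partial hG4 v x)
      exact h
    rw [hin.fderiv, ContinuousLinearMap.comp_apply, ContinuousLinearMap.apply_apply,
      Cb4.fderiv₃_symm₂₃ hG4 x v w' w]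
  rw [he] at h3
  exact h3

/-- **Gaussian lower bound for the smoothed atom, uniformly in the scale**: if `Ψ ≥ c₁e^{−c₂‖x‖²}`
(`c₁ > 0`) then for `t > 0` there is `m > 0` with `E_{C_s}[Ψ(y+·)] ≥ m e^{−2c₂‖y‖²}` for all `y` and all
`s` near `t` (Jensen: `E_{C_s}[e^{−2c₂‖ζ‖²}] ≥ e^{−2c₂E_{C_s}‖ζ‖²}`, and the second moments are bounded near
`t` by Fernique's theorem). [cite: DapratoZabczyk1992, Thm 2.7] -/
theorem eventually_mul_exp_neg_le_atom (D : CovDecomposition N) {Ψ : EuclideanSpace ℝ (Fin N) → ℝ}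
    (hΨc : Continuous Ψ) {B : ℝ} (hΨB : ∀ x, |Ψ x| ≤ B) {c₁ c₂ : ℝ} (hc₁ : 0 < c₁) (hc₂ : 0 ≤ c₂)
    (hlow : ∀ x, c₁ * Real.exp (-(c₂ * ‖x‖ ^ 2)) ≤ Ψ x) {t : ℝ} (ht : 0 < t) :
    ∃ m : ℝ, 0 < m ∧ ∀ᶠ s in 𝓝 t, ∀ y,
      m * Real.exp (-(2 * c₂ * ‖y‖ ^ 2)) ≤ ∫ ζ, Ψ (y + ζ) ∂(multivariateGaussian 0 (D.C s)) := by
  obtain ⟨cF, hcF, BF, hF⟩ := exists_integral_exp_mul_norm_sq_gaussian_le (ι := Fin N)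
  -- the entries of `C_s` are bounded near `t`
  set L : ℝ := (∑ i, ∑ j, |D.C t i j|) + 1 with hL
  have hL0 : 0 < L := by positivity
  have evL : ∀ᶠ s in 𝓝 t, (∑ i, ∑ j, |D.C s i j|) ≤ L := by
    have hcont : ∀ i j, Tendsto (fun s => |D.C s i j|) (𝓝 t) (𝓝 |D.C t i j|) :=
      fun i j => ((D.hasDerivAt_C t ht.le i j).continuousAt.tendsto).abs
    have hsum : Tendsto (fun s => ∑ i, ∑ j, |D.C s i j|) (𝓝 t) (𝓝 (∑ i, ∑ j, |D.C t i j|)) :=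
      tendsto_finsetSum _ fun i _ => tendsto_finsetSum _ fun j _ => hcont i j
    exact (tendsto_order.1 hsum).2 L (by rw [hL]; linarith) |>.mono fun s hs => hs.le
  set a : ℝ := cF / L with ha
  have ha0 : 0 < a := by positivity
  set M₂ : ℝ := BF / a with hM₂
  refine ⟨c₁ * Real.exp (-(2 * c₂ * M₂)), by positivity, ?_⟩
  filter_upwards [evL, lt_mem_nhds ht] with s hsL hs0 y
  set P := multivariateGaussian 0 (D.C s) with hP
  have hPSD : (D.C s).PosSemidef := D.posSemidef_C hs0.le
  have haL : a * (∑ i, ∑ j, |D.C s i j|) ≤ cF := by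
    calc a * (∑ i, ∑ j, |D.C s i j|) ≤ a * L := mul_le_mul_of_nonneg_left hsL ha0.le
      _ = cF := by rw [ha]; field_simp
  obtain ⟨hIexp, hexpB⟩ := hF (D.C s) hPSD a ha0.le haL
  -- second moment bound
  have h2i : Integrable (fun w : EuclideanSpace ℝ (Fin N) => ‖w‖ ^ 2) P :=
    (IsGaussian.memLp_id P 2 (by simp)).integrable_norm_pow (by norm_num)
  have h2m : ∫ w, ‖w‖ ^ 2 ∂P ≤ M₂ := by
    have hpt : ∀ w : EuclideanSpace ℝ (Fin N), ‖w‖ ^ 2 ≤ a⁻¹ * Real.exp (a * ‖w‖ ^ 2) := by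
      intro w
      have h := Real.add_one_le_exp (a * ‖w‖ ^ 2)
      rw [le_inv_mul_iff₀' ha0]
      nlinarith
    calc ∫ w, ‖w‖ ^ 2 ∂P ≤ ∫ w, a⁻¹ * Real.exp (a * ‖w‖ ^ 2) ∂P :=
          integral_mono h2i (hIexp.const_mul _) hpt
      _ = a⁻¹ * ∫ w, Real.exp (a * ‖w‖ ^ 2) ∂P := integral_const_mul _ _
      _ ≤ a⁻¹ * BF := mul_le_mul_of_nonneg_left hexpB (inv_nonneg.2 ha0.le)
      _ = M₂ := by rw [hM₂, div_eq_inv_mul]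
  -- Jensen for `r ↦ e^{−2c₂ r}`
  have hgc : Continuous fun ζ : EuclideanSpace ℝ (Fin N) => Real.exp (-(2 * c₂ * ‖ζ‖ ^ 2)) := by
    fun_prop
  have hgi : Integrable (fun ζ : EuclideanSpace ℝ (Fin N) => Real.exp (-(2 * c₂ * ‖ζ‖ ^ 2))) P :=
    Integrable.of_bound hgc.aestronglyMeasurable 1 (Eventually.of_forall fun ζ => by
      rw [Real.norm_eq_abs, abs_of_pos (Real.exp_pos _)]
      exact Real.exp_le_one_iff.2 (by nlinarith [norm_nonneg ζ]))
  have hconv : ConvexOn ℝ univ (fun r : ℝ => Real.exp (-(2 * c₂) * r)) := by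
    have h := convexOn_exp.comp_linearMap ((-(2 * c₂)) • (LinearMap.id : ℝ →ₗ[ℝ] ℝ))
    have he : (Real.exp ∘ ⇑((-(2 * c₂)) • (LinearMap.id : ℝ →ₗ[ℝ] ℝ))) =
        fun r : ℝ => Real.exp (-(2 * c₂) * r) := by
      funext r; simp [Function.comp, smul_eq_mul]
    rw [he] at h
    simpa using h
  have hJ : Real.exp (-(2 * c₂) * ∫ w, ‖w‖ ^ 2 ∂P) ≤ ∫ ζ, Real.exp (-(2 * c₂ * ‖ζ‖ ^ 2)) ∂P := by
    have h := hconv.map_integral_le (μ := P) (f := fun w : EuclideanSpace ℝ (Fin N) => ‖w‖ ^ 2)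
      (Real.continuous_exp.comp (continuous_const.mul continuous_id)).continuousOn isClosed_univ
      (Eventually.of_forall fun _ => mem_univ _) h2i
      (by
        have he : ((fun r : ℝ => Real.exp (-(2 * c₂) * r)) ∘ fun w : EuclideanSpace ℝ (Fin N) => ‖w‖ ^ 2) =
            fun ζ => Real.exp (-(2 * c₂ * ‖ζ‖ ^ 2)) := by
          funext ζ; simp only [Function.comp]; ring_nf
        rw [he]; exact hgi)
    refine h.trans_eq (integral_congr_ae (Eventually.of_forall fun ζ => ?_))
    simp only []; ring_nf
  have hJ' : Real.exp (-(2 * c₂ * M₂)) ≤ ∫ ζ, Real.exp (-(2 * c₂ * ‖ζ‖ ^ 2)) ∂P := by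
    refine le_trans (Real.exp_le_exp.2 ?_) hJ
    nlinarith
  -- the pointwise lower bound and integration
  have hI : Integrable (fun ζ => Ψ (y + ζ)) P :=
    Integrable.of_bound (hΨc.comp (continuous_const.add continuous_id)).aestronglyMeasurable B
      (Eventually.of_forall fun ζ => by rw [Real.norm_eq_abs]; exact hΨB _)
  have hpt : ∀ ζ : EuclideanSpace ℝ (Fin N),
      c₁ * Real.exp (-(2 * c₂ * ‖y‖ ^ 2)) * Real.exp (-(2 * c₂ * ‖ζ‖ ^ 2)) ≤ Ψ (y + ζ) := by
    intro ζ
    refine le_trans ?_ (hlow (y + ζ))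
    rw [mul_assoc, ← Real.exp_add]
    refine mul_le_mul_of_nonneg_left (Real.exp_le_exp.2 ?_) hc₁.le
    have h2 : ‖y + ζ‖ ^ 2 ≤ 2 * ‖y‖ ^ 2 + 2 * ‖ζ‖ ^ 2 := by
      nlinarith [norm_add_le y ζ, norm_nonneg (y + ζ), norm_nonneg y, norm_nonneg ζ,
        sq_nonneg (‖y‖ - ‖ζ‖)]
    nlinarith
  calc c₁ * Real.exp (-(2 * c₂ * M₂)) * Real.exp (-(2 * c₂ * ‖y‖ ^ 2))
      = c₁ * Real.exp (-(2 * c₂ * ‖y‖ ^ 2)) * Real.exp (-(2 * c₂ * M₂)) := by ring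
    _ ≤ c₁ * Real.exp (-(2 * c₂ * ‖y‖ ^ 2)) * ∫ ζ, Real.exp (-(2 * c₂ * ‖ζ‖ ^ 2)) ∂P :=
        mul_le_mul_of_nonneg_left hJ' (by positivity)
    _ = ∫ ζ, c₁ * Real.exp (-(2 * c₂ * ‖y‖ ^ 2)) * Real.exp (-(2 * c₂ * ‖ζ‖ ^ 2)) ∂P :=
        (integral_const_mul _ _).symm
    _ ≤ ∫ ζ, Ψ (y + ζ) ∂P := integral_mono (hgi.const_mul _) hI hpt

set_option maxHeartbeats 2000000 in
/-- **Per-pair master bound** for the tempered slope of `Σ Ċ^{kl} Z m_k m_l/u` (pure real algebra):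
with `u = W/Z`, `z = P/Z`, `w = Q/Z`, `m = w − uz` at the two times, the exact second-order identity
`q_s − q_t − h q̇ = S_Z θ_t + Z_s R₂ + Dθ_t·r` and elementary bounds give
`|T_{kl}| ≤ |h|(e Φ₁ + |h| Φ₂ + Φ₃)`, where `Φ₃` is linear in the bounds `D_u, D_z, D_m` of the normalized
increments. [cite: Rudin1976, Thm 5.15] -/
theorem sqrtEnergy_pair_bound
    {Zs Zt Ws Wt P1 P0 Q1 Q0 R1 R0 S1 S0 zd wd pd qd pd' qd' Cs Ct cd h e : ℝ}
    {a b zB wB L KD KC KCd KZ Du Dz Dm : ℝ}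
    (hZs : 0 < Zs) (hZt : 0 < Zt) (ha : 0 < a)
    (hWs : a * Zs ≤ Ws) (hWs' : Ws ≤ b * Zs) (hWt : a * Zt ≤ Wt) (hWt' : Wt ≤ b * Zt) (hKZ : Zs ≤ KZ)
    (hzB : 0 ≤ zB) (hwB : 0 ≤ wB) (hL : 0 ≤ L) (hKD : 0 ≤ KD) (hKC : 0 ≤ KC) (hKCd : 0 ≤ KCd)
    (hDu : 0 ≤ Du) (hDm : 0 ≤ Dm) (he : 0 ≤ e) (hh : |h| ≤ 1)
    (hP0 : |P0| ≤ zB * Zt) (hP1 : |P1| ≤ zB * Zs) (hQ0 : |Q0| ≤ wB * Zt) (hQ1 : |Q1| ≤ wB * Zs)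
    (hR0 : |R0| ≤ zB * Zt) (hR1 : |R1| ≤ zB * Zs) (hS0 : |S0| ≤ wB * Zt) (hS1 : |S1| ≤ wB * Zs)
    (cZ : |Zs - Zt| ≤ L * |h|) (cW : |Ws - Wt| ≤ L * |h|) (cP : |P1 - P0| ≤ L * |h|)
    (cQ : |Q1 - Q0| ≤ L * |h|) (cR : |R1 - R0| ≤ L * |h|) (cS : |S1 - S0| ≤ L * |h|)
    (fZ : |Zs - Zt - h * zd| ≤ e * |h|) (fW : |Ws - Wt - h * wd| ≤ e * |h|)
    (fP : |P1 - P0 - h * pd| ≤ e * |h|) (fQ : |Q1 - Q0 - h * qd| ≤ e * |h|)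
    (fR : |R1 - R0 - h * pd'| ≤ e * |h|) (fS : |S1 - S0 - h * qd'| ≤ e * |h|)
    (fC : |Cs - Ct - h * cd| ≤ e * |h|)
    (bzd : |zd| ≤ KD) (bwd : |wd| ≤ KD) (bpd : |pd| ≤ KD) (bqd : |qd| ≤ KD) (bpd' : |pd'| ≤ KD)
    (bqd' : |qd'| ≤ KD) (bCt : |Ct| ≤ KC) (bcd : |cd| ≤ KCd)
    (dU : |((Ws - Wt) - Wt * Zt⁻¹ * (Zs - Zt)) * Zs⁻¹| ≤ Du)
    (dZk : |((P1 - P0) - P0 * Zt⁻¹ * (Zs - Zt)) * Zs⁻¹| ≤ Dz)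
    (dZl : |((R1 - R0) - R0 * Zt⁻¹ * (Zs - Zt)) * Zs⁻¹| ≤ Dz)
    (dMk : |(((Q1 - Q0) - Q0 * Zt⁻¹ * (Zs - Zt)) - Ws * Zs⁻¹ * ((P1 - P0) - P0 * Zt⁻¹ * (Zs - Zt)) -
      P0 * Zt⁻¹ * ((Ws - Wt) - Wt * Zt⁻¹ * (Zs - Zt))) * Zs⁻¹| ≤ Dm)
    (dMl : |(((S1 - S0) - S0 * Zt⁻¹ * (Zs - Zt)) - Ws * Zs⁻¹ * ((R1 - R0) - R0 * Zt⁻¹ * (Zs - Zt)) -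
      R0 * Zt⁻¹ * ((Ws - Wt) - Wt * Zt⁻¹ * (Zs - Zt))) * Zs⁻¹| ≤ Dm) :
    |Cs * (Zs * ((Q1 * Zs⁻¹ - Ws * Zs⁻¹ * (P1 * Zs⁻¹)) * (S1 * Zs⁻¹ - Ws * Zs⁻¹ * (R1 * Zs⁻¹)) *
        (Ws * Zs⁻¹)⁻¹)) -
      Ct * (Zt * ((Q0 * Zt⁻¹ - Wt * Zt⁻¹ * (P0 * Zt⁻¹)) * (S0 * Zt⁻¹ - Wt * Zt⁻¹ * (R0 * Zt⁻¹)) *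
        (Wt * Zt⁻¹)⁻¹)) -
      h * (cd * (Zt * ((Q0 * Zt⁻¹ - Wt * Zt⁻¹ * (P0 * Zt⁻¹)) * (S0 * Zt⁻¹ - Wt * Zt⁻¹ * (R0 * Zt⁻¹)) *
          (Wt * Zt⁻¹)⁻¹)) +
        Ct * (zd * ((Q0 * Zt⁻¹ - Wt * Zt⁻¹ * (P0 * Zt⁻¹)) * (S0 * Zt⁻¹ - Wt * Zt⁻¹ * (R0 * Zt⁻¹)) *
            (Wt * Zt⁻¹)⁻¹) +
          Zt * (((qd * Zt⁻¹ - Q0 * Zt⁻¹ * (zd * Zt⁻¹) - wd * Zt⁻¹ * (P0 * Zt⁻¹) - Wt * Zt⁻¹ * (pd * Zt⁻¹) +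
                2 * (Wt * Zt⁻¹ * (P0 * Zt⁻¹) * (zd * Zt⁻¹))) * (S0 * Zt⁻¹ - Wt * Zt⁻¹ * (R0 * Zt⁻¹)) +
              (Q0 * Zt⁻¹ - Wt * Zt⁻¹ * (P0 * Zt⁻¹)) *
                (qd' * Zt⁻¹ - S0 * Zt⁻¹ * (zd * Zt⁻¹) - wd * Zt⁻¹ * (R0 * Zt⁻¹) - Wt * Zt⁻¹ * (pd' * Zt⁻¹) +
                  2 * (Wt * Zt⁻¹ * (R0 * Zt⁻¹) * (zd * Zt⁻¹)))) * (Wt * Zt⁻¹)⁻¹ -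
            (Q0 * Zt⁻¹ - Wt * Zt⁻¹ * (P0 * Zt⁻¹)) * (S0 * Zt⁻¹ - Wt * Zt⁻¹ * (R0 * Zt⁻¹)) *
              (wd * Zt⁻¹ - Wt * Zt⁻¹ * (zd * Zt⁻¹)) * ((Wt * Zt⁻¹)⁻¹ * (Wt * Zt⁻¹)⁻¹))))| ≤
    |h| * (e * (KZ * (wB + b * zB) ^ 2 / a + (KCd + KC) * ((wB + b * zB) ^ 2 / a +
          (2 * ((1 + wB) + b * (1 + zB) + zB * (1 + b)) * (wB + b * zB) / a +
            (wB + b * zB) ^ 2 * (1 + b) / a ^ 2))) +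
      |h| * (KCd * (KD * (wB + b * zB) ^ 2 / a +
          (2 * (KD * (1 + wB + zB + b + 2 * b * zB)) * (wB + b * zB) / a +
            (wB + b * zB) ^ 2 * (KD * (1 + b)) / a ^ 2))) +
      (KCd + KC) * ((((1 + wB) * L + b * ((1 + zB) * L) + zB * ((1 + b) * L)) +
            (wB + b * zB) * ((1 + b) * L) / a) * (Dm + (wB + b * zB) * Du / a) / a +
          2 * (wB + b * zB) * ((1 + zB) * L) * Du / a)) := by
  -- names
  have hZsne : Zs ≠ 0 := hZs.ne'
  have hZtne : Zt ≠ 0 := hZt.ne'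
  have hWsne : Ws ≠ 0 := ((mul_pos ha hZs).trans_le hWs).ne'
  have hWtne : Wt ≠ 0 := ((mul_pos ha hZt).trans_le hWt).ne'
  obtain ⟨us, hus⟩ : ∃ x : ℝ, x = Ws * Zs⁻¹ := ⟨_, rfl⟩
  obtain ⟨ut, hut⟩ : ∃ x : ℝ, x = Wt * Zt⁻¹ := ⟨_, rfl⟩
  obtain ⟨zks, hzks⟩ : ∃ x : ℝ, x = P1 * Zs⁻¹ := ⟨_, rfl⟩
  obtain ⟨zk, hzk⟩ : ∃ x : ℝ, x = P0 * Zt⁻¹ := ⟨_, rfl⟩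
  obtain ⟨wks, hwks⟩ : ∃ x : ℝ, x = Q1 * Zs⁻¹ := ⟨_, rfl⟩
  obtain ⟨wk, hwk⟩ : ∃ x : ℝ, x = Q0 * Zt⁻¹ := ⟨_, rfl⟩
  obtain ⟨zls, hzls⟩ : ∃ x : ℝ, x = R1 * Zs⁻¹ := ⟨_, rfl⟩
  obtain ⟨zl, hzl⟩ : ∃ x : ℝ, x = R0 * Zt⁻¹ := ⟨_, rfl⟩
  obtain ⟨wls, hwls⟩ : ∃ x : ℝ, x = S1 * Zs⁻¹ := ⟨_, rfl⟩
  obtain ⟨wl, hwl⟩ : ∃ x : ℝ, x = S0 * Zt⁻¹ := ⟨_, rfl⟩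
  have haus : a ≤ us := by rw [hus, ← div_eq_mul_inv, le_div_iff₀ hZs]; exact hWs
  have hubs : us ≤ b := by rw [hus, ← div_eq_mul_inv, div_le_iff₀ hZs]; exact hWs'
  have haut : a ≤ ut := by rw [hut, ← div_eq_mul_inv, le_div_iff₀ hZt]; exact hWt
  have hubt : ut ≤ b := by rw [hut, ← div_eq_mul_inv, div_le_iff₀ hZt]; exact hWt'
  have bDZ0 : |Zs - Zt| ≤ L * |h| := cZ
  have hus0 : 0 < us := ha.trans_le haus
  have hut0 : 0 < ut := ha.trans_le haut
  have husne : us ≠ 0 := hus0.ne'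
  have hutne : ut ≠ 0 := hut0.ne'
  have hb : 0 ≤ b := ha.le.trans (haus.trans hubs)
  have hab : a ≤ b := haus.trans hubs
  have habs_ut : |ut| ≤ b := by rw [abs_of_pos hut0]; exact hubt
  have habs_us : |us| ≤ b := by rw [abs_of_pos hus0]; exact hubs
  have hius : us⁻¹ ≤ a⁻¹ := inv_anti₀ ha haus
  have hiut : ut⁻¹ ≤ a⁻¹ := inv_anti₀ ha haut
  have hius0 : 0 ≤ us⁻¹ := (inv_pos.2 hus0).le
  have hiut0 : 0 ≤ ut⁻¹ := (inv_pos.2 hut0).le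
  have hia0 : 0 ≤ a⁻¹ := (inv_pos.2 ha).le
  -- normalized atom bounds
  have nb : ∀ {X Z c : ℝ}, 0 < Z → |X| ≤ c * Z → |X * Z⁻¹| ≤ c := fun {X Z c} hZ hX => by
    rw [abs_mul, abs_inv, abs_of_pos hZ, ← div_eq_mul_inv, div_le_iff₀ hZ]; exact hX
  have bzks : |zks| ≤ zB := by rw [hzks]; exact nb hZs hP1
  have bzk : |zk| ≤ zB := by rw [hzk]; exact nb hZt hP0
  have bwks : |wks| ≤ wB := by rw [hwks]; exact nb hZs hQ1
  have bwk : |wk| ≤ wB := by rw [hwk]; exact nb hZt hQ0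
  have bzls : |zls| ≤ zB := by rw [hzls]; exact nb hZs hR1
  have bzl : |zl| ≤ zB := by rw [hzl]; exact nb hZt hR0
  have bwls : |wls| ≤ wB := by rw [hwls]; exact nb hZs hS1
  have bwl : |wl| ≤ wB := by rw [hwl]; exact nb hZt hS0
  obtain ⟨mB, hmB⟩ : ∃ x : ℝ, x = wB + b * zB := ⟨_, rfl⟩
  have hmB0 : 0 ≤ mB := by rw [hmB]; positivity
  have bm : ∀ {w u z : ℝ}, |w| ≤ wB → |u| ≤ b → |z| ≤ zB → |w - u * z| ≤ mB := by
    intro w u z hw hu hz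
    calc |w - u * z| ≤ |w| + |u * z| := abs_sub _ _
      _ ≤ wB + b * zB := by rw [abs_mul]; exact add_le_add hw (mul_le_mul hu hz (abs_nonneg _) hb)
      _ = mB := hmB.symm
  obtain ⟨mk, hmk⟩ : ∃ x : ℝ, x = wk - ut * zk := ⟨_, rfl⟩
  obtain ⟨ml, hml⟩ : ∃ x : ℝ, x = wl - ut * zl := ⟨_, rfl⟩
  obtain ⟨mks, hmks⟩ : ∃ x : ℝ, x = wks - us * zks := ⟨_, rfl⟩
  obtain ⟨mls, hmls⟩ : ∃ x : ℝ, x = wls - us * zls := ⟨_, rfl⟩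
  have bmk : |mk| ≤ mB := by rw [hmk]; exact bm bwk habs_ut bzk
  have bml : |ml| ≤ mB := by rw [hml]; exact bm bwl habs_ut bzl
  have bmks : |mks| ≤ mB := by rw [hmks]; exact bm bwks habs_us bzks
  have bmls : |mls| ≤ mB := by rw [hmls]; exact bm bwls habs_us bzls
  -- increments
  obtain ⟨DZ, hDZ⟩ : ∃ x : ℝ, x = Zs - Zt := ⟨_, rfl⟩
  obtain ⟨Du', hDu'⟩ : ∃ x : ℝ, x = (Ws - Wt) - ut * DZ := ⟨_, rfl⟩
  obtain ⟨Dzk, hDzk⟩ : ∃ x : ℝ, x = (P1 - P0) - zk * DZ := ⟨_, rfl⟩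
  obtain ⟨Dzl, hDzl⟩ : ∃ x : ℝ, x = (R1 - R0) - zl * DZ := ⟨_, rfl⟩
  obtain ⟨Dwk, hDwk⟩ : ∃ x : ℝ, x = (Q1 - Q0) - wk * DZ := ⟨_, rfl⟩
  obtain ⟨Dwl, hDwl⟩ : ∃ x : ℝ, x = (S1 - S0) - wl * DZ := ⟨_, rfl⟩
  obtain ⟨Dmk, hDmk⟩ : ∃ x : ℝ, x = Dwk - us * Dzk - zk * Du' := ⟨_, rfl⟩
  obtain ⟨Dml, hDml⟩ : ∃ x : ℝ, x = Dwl - us * Dzl - zl * Du' := ⟨_, rfl⟩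
  have hL1 : 0 ≤ L * |h| := by positivity
  have bDZ : |DZ| ≤ L * |h| := by rw [hDZ]; exact cZ
  have bDu : |Du'| ≤ (1 + b) * L * |h| := by
    calc |Du'| ≤ |Ws - Wt| + |ut * DZ| := by rw [hDu']; exact abs_sub _ _
      _ ≤ L * |h| + b * (L * |h|) := by
          rw [abs_mul]; exact add_le_add cW (mul_le_mul habs_ut bDZ (abs_nonneg _) hb)
      _ = (1 + b) * L * |h| := by ring
  have bDg : ∀ {X c : ℝ} {x : ℝ}, |X| ≤ L * |h| → |x| ≤ c → 0 ≤ c → |X - x * DZ| ≤ (1 + c) * L * |h| := by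
    intro X c x hX hx hc
    calc |X - x * DZ| ≤ |X| + |x * DZ| := abs_sub _ _
      _ ≤ L * |h| + c * (L * |h|) := by
          rw [abs_mul]; exact add_le_add hX (mul_le_mul hx bDZ (abs_nonneg _) hc)
      _ = (1 + c) * L * |h| := by ring
  have bDzk : |Dzk| ≤ (1 + zB) * L * |h| := by rw [hDzk]; exact bDg cP bzk hzB
  have bDzl : |Dzl| ≤ (1 + zB) * L * |h| := by rw [hDzl]; exact bDg cR bzl hzB
  have bDwk : |Dwk| ≤ (1 + wB) * L * |h| := by rw [hDwk]; exact bDg cQ bwk hwB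
  have bDwl : |Dwl| ≤ (1 + wB) * L * |h| := by rw [hDwl]; exact bDg cS bwl hwB
  obtain ⟨Lm, hLm⟩ : ∃ x : ℝ, x = (1 + wB) * L + b * ((1 + zB) * L) + zB * ((1 + b) * L) := ⟨_, rfl⟩
  have hLm0 : 0 ≤ Lm := by rw [hLm]; positivity
  have bDm : ∀ {Dw Dz' z : ℝ}, |Dw| ≤ (1 + wB) * L * |h| → |Dz'| ≤ (1 + zB) * L * |h| → |z| ≤ zB →
      |Dw - us * Dz' - z * Du'| ≤ Lm * |h| := by
    intro Dw Dz' z hDw hDz' hz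
    calc |Dw - us * Dz' - z * Du'| ≤ |Dw| + |us * Dz'| + |z * Du'| := by
          exact (abs_sub _ _).trans (add_le_add (abs_sub _ _) le_rfl)
      _ ≤ (1 + wB) * L * |h| + b * ((1 + zB) * L * |h|) + zB * ((1 + b) * L * |h|) := by
          rw [abs_mul, abs_mul]
          exact add_le_add (add_le_add hDw (mul_le_mul habs_us hDz' (abs_nonneg _) hb))
            (mul_le_mul hz bDu (abs_nonneg _) hzB)
      _ = Lm * |h| := by rw [hLm]; ring
  have bDmk : |Dmk| ≤ Lm * |h| := by rw [hDmk]; exact bDm bDwk bDzk bzk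
  have bDml : |Dml| ≤ Lm * |h| := by rw [hDml]; exact bDm bDwl bDzl bzl
  -- normalized increments (hypotheses)
  have dU' : |Du' * Zs⁻¹| ≤ Du := by simpa only [hDu', hut, hDZ] using dU
  have dZk' : |Dzk * Zs⁻¹| ≤ Dz := by simpa only [hDzk, hzk, hDZ] using dZk
  have dZl' : |Dzl * Zs⁻¹| ≤ Dz := by simpa only [hDzl, hzl, hDZ] using dZl
  have dMk' : |Dmk * Zs⁻¹| ≤ Dm := by simpa only [hDmk, hDwk, hDzk, hDu', hus, hzk, hwk, hut, hDZ] using dMk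
  have dMl' : |Dml * Zs⁻¹| ≤ Dm := by simpa only [hDml, hDwl, hDzl, hDu', hus, hzl, hwl, hut, hDZ] using dMl
  -- fine remainders
  obtain ⟨SZ, hSZ⟩ : ∃ x : ℝ, x = Zs - Zt - h * zd := ⟨_, rfl⟩
  obtain ⟨ru, hru⟩ : ∃ x : ℝ, x = (Ws - Wt - h * wd) - ut * SZ := ⟨_, rfl⟩
  obtain ⟨rzk, hrzk⟩ : ∃ x : ℝ, x = (P1 - P0 - h * pd) - zk * SZ := ⟨_, rfl⟩
  obtain ⟨rzl, hrzl⟩ : ∃ x : ℝ, x = (R1 - R0 - h * pd') - zl * SZ := ⟨_, rfl⟩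
  obtain ⟨rwk, hrwk⟩ : ∃ x : ℝ, x = (Q1 - Q0 - h * qd) - wk * SZ := ⟨_, rfl⟩
  obtain ⟨rwl, hrwl⟩ : ∃ x : ℝ, x = (S1 - S0 - h * qd') - wl * SZ := ⟨_, rfl⟩
  obtain ⟨rmk, hrmk⟩ : ∃ x : ℝ, x = rwk - ut * rzk - zk * ru := ⟨_, rfl⟩
  obtain ⟨rml, hrml⟩ : ∃ x : ℝ, x = rwl - ut * rzl - zl * ru := ⟨_, rfl⟩
  have he1 : 0 ≤ e * |h| := by positivity
  have bSZ : |SZ| ≤ e * |h| := by rw [hSZ]; exact fZ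
  have brg : ∀ {X c x : ℝ}, |X| ≤ e * |h| → |x| ≤ c → 0 ≤ c → |X - x * SZ| ≤ (1 + c) * (e * |h|) := by
    intro X c x hX hx hc
    calc |X - x * SZ| ≤ |X| + |x * SZ| := abs_sub _ _
      _ ≤ e * |h| + c * (e * |h|) := by
          rw [abs_mul]; exact add_le_add hX (mul_le_mul hx bSZ (abs_nonneg _) hc)
      _ = (1 + c) * (e * |h|) := by ring
  have bru : |ru| ≤ (1 + b) * (e * |h|) := by rw [hru]; exact brg fW habs_ut hb
  have brzk : |rzk| ≤ (1 + zB) * (e * |h|) := by rw [hrzk]; exact brg fP bzk hzB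
  have brzl : |rzl| ≤ (1 + zB) * (e * |h|) := by rw [hrzl]; exact brg fR bzl hzB
  have brwk : |rwk| ≤ (1 + wB) * (e * |h|) := by rw [hrwk]; exact brg fQ bwk hwB
  have brwl : |rwl| ≤ (1 + wB) * (e * |h|) := by rw [hrwl]; exact brg fS bwl hwB
  obtain ⟨Lr, hLr⟩ : ∃ x : ℝ, x = (1 + wB) + b * (1 + zB) + zB * (1 + b) := ⟨_, rfl⟩
  have hLr0 : 0 ≤ Lr := by rw [hLr]; positivity
  have brm : ∀ {rw rz z : ℝ}, |rw| ≤ (1 + wB) * (e * |h|) → |rz| ≤ (1 + zB) * (e * |h|) → |z| ≤ zB →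
      |rw - ut * rz - z * ru| ≤ Lr * (e * |h|) := by
    intro rw rz z hrw hrz hz
    calc |rw - ut * rz - z * ru| ≤ |rw| + |ut * rz| + |z * ru| := by
          exact (abs_sub _ _).trans (add_le_add (abs_sub _ _) le_rfl)
      _ ≤ (1 + wB) * (e * |h|) + b * ((1 + zB) * (e * |h|)) + zB * ((1 + b) * (e * |h|)) := by
          rw [abs_mul, abs_mul]
          exact add_le_add (add_le_add hrw (mul_le_mul habs_ut hrz (abs_nonneg _) hb))
            (mul_le_mul hz bru (abs_nonneg _) hzB)
      _ = Lr * (e * |h|) := by rw [hLr]; ring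
  have brmk : |rmk| ≤ Lr * (e * |h|) := by rw [hrmk]; exact brm brwk brzk bzk
  have brml : |rml| ≤ Lr * (e * |h|) := by rw [hrml]; exact brm brwl brzl bzl
  ---------------------------------------------------------------- the three pieces of `Rq`
  obtain ⟨θt, hθt⟩ : ∃ x : ℝ, x = mk * ml * ut⁻¹ := ⟨_, rfl⟩
  obtain ⟨θs, hθs⟩ : ∃ x : ℝ, x = mks * mls * us⁻¹ := ⟨_, rfl⟩
  have bθ : ∀ {m₁ m₂ v : ℝ}, |m₁| ≤ mB → |m₂| ≤ mB → 0 < v → a ≤ v → |m₁ * m₂ * v⁻¹| ≤ mB ^ 2 * a⁻¹ := by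
    intro m₁ m₂ v h1 h2 hv hav
    rw [abs_mul, abs_mul, abs_inv, abs_of_pos hv]
    calc |m₁| * |m₂| * v⁻¹ ≤ mB * mB * a⁻¹ :=
          mul_le_mul (mul_le_mul h1 h2 (abs_nonneg _) hmB0) (inv_anti₀ ha hav)
            (inv_pos.2 hv).le (by positivity)
      _ = mB ^ 2 * a⁻¹ := by ring
  have bθt : |θt| ≤ mB ^ 2 * a⁻¹ := by rw [hθt]; exact bθ bmk bml hut0 haut
  have bθs : |θs| ≤ mB ^ 2 * a⁻¹ := by rw [hθs]; exact bθ bmks bmls hus0 haus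
  -- (i) `S_Z θ_t`
  have b1 : |SZ * θt| ≤ e * |h| * (mB ^ 2 * a⁻¹) := by
    rw [abs_mul]; exact mul_le_mul bSZ bθt (abs_nonneg _) he1
  -- (ii) `Z_s R₂`
  obtain ⟨ZR2, hZR2⟩ : ∃ x : ℝ, x = (Dmk - mk * Du' * ut⁻¹) * (Dml * Zs⁻¹ - ml * (Du' * Zs⁻¹) * ut⁻¹) * us⁻¹ -
    (ml * Dzk + mk * Dzl) * (Du' * Zs⁻¹) * ut⁻¹ := ⟨_, rfl⟩
  obtain ⟨R2B, hR2B⟩ : ∃ x : ℝ, x = ((Lm + mB * ((1 + b) * L) / a) * (Dm + mB * Du / a) / a +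
    2 * mB * ((1 + zB) * L) * Du / a) := ⟨_, rfl⟩
  have b2 : |ZR2| ≤ |h| * R2B := by
    have x1 : |Dmk - mk * Du' * ut⁻¹| ≤ (Lm + mB * ((1 + b) * L) / a) * |h| := by
      calc |Dmk - mk * Du' * ut⁻¹| ≤ |Dmk| + |mk * Du' * ut⁻¹| := abs_sub _ _
        _ ≤ Lm * |h| + mB * ((1 + b) * L * |h|) * a⁻¹ := by
            rw [abs_mul, abs_mul, abs_inv, abs_of_pos hut0]
            exact add_le_add bDmk (mul_le_mul (mul_le_mul bmk bDu (abs_nonneg _) hmB0) hiut hiut0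
              (by positivity))
        _ = (Lm + mB * ((1 + b) * L) / a) * |h| := by ring
    have x2 : |Dml * Zs⁻¹ - ml * (Du' * Zs⁻¹) * ut⁻¹| ≤ Dm + mB * Du / a := by
      calc |Dml * Zs⁻¹ - ml * (Du' * Zs⁻¹) * ut⁻¹| ≤ |Dml * Zs⁻¹| + |ml * (Du' * Zs⁻¹) * ut⁻¹| :=
            abs_sub _ _
        _ ≤ Dm + mB * Du * a⁻¹ := by
            rw [abs_mul (ml * (Du' * Zs⁻¹)) (ut⁻¹), abs_mul ml, abs_inv, abs_of_pos hut0]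
            exact add_le_add dMl' (mul_le_mul (mul_le_mul bml dU' (abs_nonneg _) hmB0) hiut hiut0
              (by positivity))
        _ = Dm + mB * Du / a := by ring
    have x3 : |(ml * Dzk + mk * Dzl) * (Du' * Zs⁻¹) * ut⁻¹| ≤ 2 * mB * ((1 + zB) * L) * Du / a * |h| := by
      have y1 : |ml * Dzk + mk * Dzl| ≤ 2 * mB * ((1 + zB) * L * |h|) := by
        calc |ml * Dzk + mk * Dzl| ≤ |ml * Dzk| + |mk * Dzl| := abs_add_le _ _
          _ ≤ mB * ((1 + zB) * L * |h|) + mB * ((1 + zB) * L * |h|) := by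
              rw [abs_mul, abs_mul]
              exact add_le_add (mul_le_mul bml bDzk (abs_nonneg _) hmB0)
                (mul_le_mul bmk bDzl (abs_nonneg _) hmB0)
          _ = 2 * mB * ((1 + zB) * L * |h|) := by ring
      rw [abs_mul, abs_mul, abs_inv, abs_of_pos hut0]
      calc |ml * Dzk + mk * Dzl| * |Du' * Zs⁻¹| * ut⁻¹ ≤ 2 * mB * ((1 + zB) * L * |h|) * Du * a⁻¹ :=
            mul_le_mul (mul_le_mul y1 dU' (abs_nonneg _) (by positivity)) hiut hiut0 (by positivity)
        _ = 2 * mB * ((1 + zB) * L) * Du / a * |h| := by ring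
    calc |ZR2| ≤ |(Dmk - mk * Du' * ut⁻¹) * (Dml * Zs⁻¹ - ml * (Du' * Zs⁻¹) * ut⁻¹) * us⁻¹| +
          |(ml * Dzk + mk * Dzl) * (Du' * Zs⁻¹) * ut⁻¹| := by rw [hZR2]; exact abs_sub _ _
      _ ≤ (Lm + mB * ((1 + b) * L) / a) * |h| * (Dm + mB * Du / a) * a⁻¹ +
          2 * mB * ((1 + zB) * L) * Du / a * |h| := by
          refine add_le_add ?_ x3
          have h1 : 0 ≤ (Lm + mB * ((1 + b) * L) / a) * |h| := by positivity
          have h2 : 0 ≤ Dm + mB * Du / a := by positivity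
          rw [abs_mul, abs_mul, abs_inv, abs_of_pos hus0]
          exact mul_le_mul (mul_le_mul x1 x2 (abs_nonneg _) h1) hius hius0 (mul_nonneg h1 h2)
      _ = |h| * R2B := by rw [hR2B]; ring
  -- (iii) the linear part `Dθ_t · r`
  obtain ⟨LIN, hLIN⟩ : ∃ x : ℝ, x = (rmk * ml + mk * rml) * ut⁻¹ - mk * ml * ru * (ut⁻¹ * ut⁻¹) := ⟨_, rfl⟩
  obtain ⟨LINB, hLINB⟩ : ∃ x : ℝ, x = 2 * Lr * mB / a + mB ^ 2 * (1 + b) / a ^ 2 := ⟨_, rfl⟩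
  have b3 : |LIN| ≤ e * |h| * LINB := by
    have y1 : |rmk * ml + mk * rml| ≤ 2 * Lr * mB * (e * |h|) := by
      calc |rmk * ml + mk * rml| ≤ |rmk * ml| + |mk * rml| := abs_add_le _ _
        _ ≤ Lr * (e * |h|) * mB + mB * (Lr * (e * |h|)) := by
            rw [abs_mul, abs_mul]
            exact add_le_add (mul_le_mul brmk bml (abs_nonneg _) (by positivity))
              (mul_le_mul bmk brml (abs_nonneg _) hmB0)
        _ = 2 * Lr * mB * (e * |h|) := by ring
    calc |LIN| ≤ |(rmk * ml + mk * rml) * ut⁻¹| + |mk * ml * ru * (ut⁻¹ * ut⁻¹)| := by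
          rw [hLIN]; exact abs_sub _ _
      _ ≤ 2 * Lr * mB * (e * |h|) * a⁻¹ + mB * mB * ((1 + b) * (e * |h|)) * (a⁻¹ * a⁻¹) := by
          rw [abs_mul, abs_inv, abs_of_pos hut0, abs_mul, abs_mul, abs_mul, abs_mul, abs_inv,
            abs_of_pos hut0]
          exact add_le_add (mul_le_mul y1 hiut hiut0 (by positivity))
            (mul_le_mul (mul_le_mul (mul_le_mul bmk bml (abs_nonneg _) hmB0) bru (abs_nonneg _)
              (by positivity)) (mul_le_mul hiut hiut hiut0 hia0) (by positivity) (by positivity))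
      _ = e * |h| * LINB := by rw [hLINB]; ring
  ---------------------------------------------------------------- `Rq` and the exact identity
  obtain ⟨θd, hθd⟩ : ∃ x : ℝ, x = ((qd * Zt⁻¹ - Q0 * Zt⁻¹ * (zd * Zt⁻¹) - wd * Zt⁻¹ * (P0 * Zt⁻¹) - Wt * Zt⁻¹ * (pd * Zt⁻¹) +
        2 * (Wt * Zt⁻¹ * (P0 * Zt⁻¹) * (zd * Zt⁻¹))) * (S0 * Zt⁻¹ - Wt * Zt⁻¹ * (R0 * Zt⁻¹)) +
      (Q0 * Zt⁻¹ - Wt * Zt⁻¹ * (P0 * Zt⁻¹)) *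
        (qd' * Zt⁻¹ - S0 * Zt⁻¹ * (zd * Zt⁻¹) - wd * Zt⁻¹ * (R0 * Zt⁻¹) - Wt * Zt⁻¹ * (pd' * Zt⁻¹) +
          2 * (Wt * Zt⁻¹ * (R0 * Zt⁻¹) * (zd * Zt⁻¹)))) * (Wt * Zt⁻¹)⁻¹ -
    (Q0 * Zt⁻¹ - Wt * Zt⁻¹ * (P0 * Zt⁻¹)) * (S0 * Zt⁻¹ - Wt * Zt⁻¹ * (R0 * Zt⁻¹)) *
      (wd * Zt⁻¹ - Wt * Zt⁻¹ * (zd * Zt⁻¹)) * ((Wt * Zt⁻¹)⁻¹ * (Wt * Zt⁻¹)⁻¹) := ⟨_, rfl⟩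
  obtain ⟨Rq, hRq⟩ : ∃ x : ℝ, x = Zs * θs - Zt * θt - h * (zd * θt + Zt * θd) := ⟨_, rfl⟩
  have hid : Rq = SZ * θt + ZR2 + LIN := by
    simp only [hRq, hθs, hθt, hθd, hSZ, hZR2, hLIN, hmks, hmls, hmk, hml, hwks, hwls, hwk, hwl,
      hzks, hzls, hzk, hzl, hus, hut, hDmk, hDml, hDwk, hDwl, hDzk, hDzl, hDu', hDZ, hrmk, hrml,
      hrwk, hrwl, hrzk, hrzl, hru]
    field_simp
    ring
  have bRq : |Rq| ≤ e * |h| * (mB ^ 2 * a⁻¹ + LINB) + |h| * R2B := by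
    rw [hid]
    calc |SZ * θt + ZR2 + LIN| ≤ |SZ * θt| + |ZR2| + |LIN| :=
          (abs_add_le _ _).trans (add_le_add (abs_add_le _ _) le_rfl)
      _ ≤ e * |h| * (mB ^ 2 * a⁻¹) + |h| * R2B + e * |h| * LINB := add_le_add (add_le_add b1 b2) b3
      _ = _ := by ring
  ---------------------------------------------------------------- `q̇` and the final bound
  have bZθd : |zd * θt + Zt * θd| ≤ KD * mB ^ 2 * a⁻¹ +
      (2 * (KD * (1 + wB + zB + b + 2 * b * zB)) * mB * a⁻¹ + mB ^ 2 * (KD * (1 + b)) * (a⁻¹ * a⁻¹)) := by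
    obtain ⟨Gd, hGd⟩ : ∃ x : ℝ, x = KD * (1 + wB + zB + b + 2 * b * zB) := ⟨_, rfl⟩
    -- `Z_t ṁ_k`, `Z_t ṁ_l`, `Z_t u̇`
    obtain ⟨Ak, hAk⟩ : ∃ x : ℝ, x = qd - wk * zd - wd * zk - ut * pd + 2 * (ut * zk * zd) := ⟨_, rfl⟩
    obtain ⟨Al, hAl⟩ : ∃ x : ℝ, x = qd' - wl * zd - wd * zl - ut * pd' + 2 * (ut * zl * zd) := ⟨_, rfl⟩
    obtain ⟨Au, hAu⟩ : ∃ x : ℝ, x = wd - ut * zd := ⟨_, rfl⟩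
    have gdk : ∀ {q' p' w' z' : ℝ}, |q'| ≤ KD → |p'| ≤ KD → |w'| ≤ wB → |z'| ≤ zB →
        |q' - w' * zd - wd * z' - ut * p' + 2 * (ut * z' * zd)| ≤ Gd := by
      intro q' p' w' z' hq' hp' hw' hz'
      calc _ ≤ |q'| + |w' * zd| + |wd * z'| + |ut * p'| + |2 * (ut * z' * zd)| := by
            refine (abs_add_le _ _).trans (add_le_add ((abs_sub _ _).trans (add_le_add
              ((abs_sub _ _).trans (add_le_add (abs_sub _ _) le_rfl)) le_rfl)) le_rfl)
        _ ≤ KD + wB * KD + KD * zB + b * KD + 2 * (b * zB * KD) := by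
            rw [abs_mul, abs_mul, abs_mul, abs_mul, abs_mul, abs_mul, abs_two]
            refine add_le_add (add_le_add (add_le_add (add_le_add hq' (mul_le_mul hw' bzd
              (abs_nonneg _) hwB)) (mul_le_mul bwd hz' (abs_nonneg _) hKD))
              (mul_le_mul habs_ut hp' (abs_nonneg _) hb)) ?_
            exact mul_le_mul_of_nonneg_left (mul_le_mul (mul_le_mul habs_ut hz' (abs_nonneg _) hb)
              bzd (abs_nonneg _) (by positivity)) (by norm_num)
        _ = Gd := by rw [hGd]; ring
    have gk : |Ak| ≤ Gd := by rw [hAk]; exact gdk bqd bpd bwk bzk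
    have gl : |Al| ≤ Gd := by rw [hAl]; exact gdk bqd' bpd' bwl bzl
    have gu : |Au| ≤ KD * (1 + b) := by
      rw [hAu]
      calc |wd - ut * zd| ≤ |wd| + |ut * zd| := abs_sub _ _
        _ ≤ KD + b * KD := by rw [abs_mul]; exact add_le_add bwd (mul_le_mul habs_ut bzd (abs_nonneg _) hb)
        _ = KD * (1 + b) := by ring
    have hGd0 : 0 ≤ Gd := (abs_nonneg _).trans gk
    have eθd : Zt * θd = (Ak * ml + mk * Al) * ut⁻¹ - mk * ml * Au * (ut⁻¹ * ut⁻¹) := by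
      rw [hAk, hAl, hAu]
      simp only [hθd, hmk, hml, hwk, hwl, hzk, hzl, hut]
      field_simp
    calc |zd * θt + Zt * θd| ≤ |zd * θt| + |Zt * θd| := abs_add_le _ _
      _ ≤ KD * (mB ^ 2 * a⁻¹) + (2 * Gd * mB * a⁻¹ + mB * mB * (KD * (1 + b)) * (a⁻¹ * a⁻¹)) := by
          refine add_le_add (by rw [abs_mul]; exact mul_le_mul bzd bθt (abs_nonneg _) hKD) ?_
          rw [eθd]
          calc _ ≤ |(Ak * ml + mk * Al) * ut⁻¹| + |mk * ml * Au * (ut⁻¹ * ut⁻¹)| := abs_sub _ _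
            _ ≤ 2 * Gd * mB * a⁻¹ + mB * mB * (KD * (1 + b)) * (a⁻¹ * a⁻¹) := by
                refine add_le_add ?_ ?_
                · rw [abs_mul, abs_inv, abs_of_pos hut0]
                  refine mul_le_mul ?_ hiut hiut0 (by positivity)
                  calc _ ≤ |Ak * ml| + |mk * Al| := abs_add_le _ _
                    _ ≤ Gd * mB + mB * Gd := by
                        rw [abs_mul, abs_mul]
                        exact add_le_add (mul_le_mul gk bml (abs_nonneg _) hGd0)
                          (mul_le_mul bmk gl (abs_nonneg _) hmB0)
                    _ = 2 * Gd * mB := by ring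
                · rw [abs_mul, abs_mul, abs_mul, abs_mul, abs_inv, abs_of_pos hut0]
                  exact mul_le_mul (mul_le_mul (mul_le_mul bmk bml (abs_nonneg _) hmB0) gu
                    (abs_nonneg _) (by positivity)) (mul_le_mul hiut hiut hiut0 hia0) (by positivity)
                    (by positivity)
      _ = _ := by rw [hGd]; ring
  -- `Z_s θ_s`
  have bqs : |Zs * θs| ≤ KZ * mB ^ 2 * a⁻¹ := by
    rw [abs_mul, abs_of_pos hZs]
    calc Zs * |θs| ≤ KZ * (mB ^ 2 * a⁻¹) := mul_le_mul hKZ bθs (abs_nonneg _) (hZs.le.trans hKZ)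
      _ = _ := by ring
  -- the `T` identity
  have hT : Cs * (Zs * ((Q1 * Zs⁻¹ - Ws * Zs⁻¹ * (P1 * Zs⁻¹)) * (S1 * Zs⁻¹ - Ws * Zs⁻¹ * (R1 * Zs⁻¹)) *
        (Ws * Zs⁻¹)⁻¹)) -
      Ct * (Zt * ((Q0 * Zt⁻¹ - Wt * Zt⁻¹ * (P0 * Zt⁻¹)) * (S0 * Zt⁻¹ - Wt * Zt⁻¹ * (R0 * Zt⁻¹)) *
        (Wt * Zt⁻¹)⁻¹)) -
      h * (cd * (Zt * ((Q0 * Zt⁻¹ - Wt * Zt⁻¹ * (P0 * Zt⁻¹)) * (S0 * Zt⁻¹ - Wt * Zt⁻¹ * (R0 * Zt⁻¹)) *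
          (Wt * Zt⁻¹)⁻¹)) +
        Ct * (zd * ((Q0 * Zt⁻¹ - Wt * Zt⁻¹ * (P0 * Zt⁻¹)) * (S0 * Zt⁻¹ - Wt * Zt⁻¹ * (R0 * Zt⁻¹)) *
            (Wt * Zt⁻¹)⁻¹) +
          Zt * (((qd * Zt⁻¹ - Q0 * Zt⁻¹ * (zd * Zt⁻¹) - wd * Zt⁻¹ * (P0 * Zt⁻¹) - Wt * Zt⁻¹ * (pd * Zt⁻¹) +
                2 * (Wt * Zt⁻¹ * (P0 * Zt⁻¹) * (zd * Zt⁻¹))) * (S0 * Zt⁻¹ - Wt * Zt⁻¹ * (R0 * Zt⁻¹)) +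
              (Q0 * Zt⁻¹ - Wt * Zt⁻¹ * (P0 * Zt⁻¹)) *
                (qd' * Zt⁻¹ - S0 * Zt⁻¹ * (zd * Zt⁻¹) - wd * Zt⁻¹ * (R0 * Zt⁻¹) - Wt * Zt⁻¹ * (pd' * Zt⁻¹) +
                  2 * (Wt * Zt⁻¹ * (R0 * Zt⁻¹) * (zd * Zt⁻¹)))) * (Wt * Zt⁻¹)⁻¹ -
            (Q0 * Zt⁻¹ - Wt * Zt⁻¹ * (P0 * Zt⁻¹)) * (S0 * Zt⁻¹ - Wt * Zt⁻¹ * (R0 * Zt⁻¹)) *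
              (wd * Zt⁻¹ - Wt * Zt⁻¹ * (zd * Zt⁻¹)) * ((Wt * Zt⁻¹)⁻¹ * (Wt * Zt⁻¹)⁻¹)))) =
      (Cs - Ct - h * cd) * (Zs * θs) + h * cd * (Rq + h * (zd * θt + Zt * θd)) + Ct * Rq := by
    simp only [hRq, hθs, hθt, hθd, hmks, hmls, hmk, hml, hwks, hwls, hwk, hwl, hzks, hzls, hzk,
      hzl, hus, hut]
    ring
  have habsRq : |Rq| ≤ |h| * (e * (mB ^ 2 * a⁻¹ + LINB) + R2B) := by
    refine bRq.trans_eq ?_; ring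
  have hR2B0 : 0 ≤ R2B := by rw [hR2B]; positivity
  have hLINB0 : 0 ≤ LINB := by rw [hLINB]; positivity
  have hrest0 : 0 ≤ e * (mB ^ 2 * a⁻¹ + LINB) + R2B := by positivity
  have hh0 : 0 ≤ |h| := abs_nonneg _
  obtain ⟨QdB, hQdB⟩ : ∃ x : ℝ, x = KD * mB ^ 2 * a⁻¹ +
      (2 * (KD * (1 + wB + zB + b + 2 * b * zB)) * mB * a⁻¹ + mB ^ 2 * (KD * (1 + b)) * (a⁻¹ * a⁻¹)) :=
    ⟨_, rfl⟩
  rw [← hQdB] at bZθd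
  have hQdB0 : 0 ≤ QdB := (abs_nonneg _).trans bZθd
  rw [hT]
  calc |(Cs - Ct - h * cd) * (Zs * θs) + h * cd * (Rq + h * (zd * θt + Zt * θd)) + Ct * Rq|
      ≤ |(Cs - Ct - h * cd) * (Zs * θs)| + |h * cd * (Rq + h * (zd * θt + Zt * θd))| + |Ct * Rq| :=
        (abs_add_le _ _).trans (add_le_add (abs_add_le _ _) le_rfl)
    _ ≤ e * |h| * (KZ * mB ^ 2 * a⁻¹) +
        |h| * KCd * (|h| * (e * (mB ^ 2 * a⁻¹ + LINB) + R2B) + |h| * QdB) +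
        KC * (|h| * (e * (mB ^ 2 * a⁻¹ + LINB) + R2B)) := by
        refine add_le_add (add_le_add ?_ ?_) ?_
        · rw [abs_mul]; exact mul_le_mul fC bqs (abs_nonneg _) he1
        · rw [abs_mul, abs_mul]
          refine mul_le_mul (mul_le_mul_of_nonneg_left bcd hh0) ?_ (abs_nonneg _) (by positivity)
          calc |Rq + h * (zd * θt + Zt * θd)| ≤ |Rq| + |h * (zd * θt + Zt * θd)| := abs_add_le _ _
            _ ≤ _ := by rw [abs_mul]; exact add_le_add habsRq (mul_le_mul_of_nonneg_left bZθd hh0)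
        · rw [abs_mul]; exact mul_le_mul bCt habsRq (abs_nonneg _) hKC
    _ ≤ |h| * (e * (KZ * mB ^ 2 * a⁻¹ + (KCd + KC) * (mB ^ 2 * a⁻¹ + LINB)) + |h| * (KCd * QdB) +
        (KCd + KC) * R2B) := by
        have hx := mul_nonneg (mul_nonneg (mul_nonneg hh0 hKCd) hrest0) (sub_nonneg.2 hh)
        have hdiff : |h| * (e * (KZ * mB ^ 2 * a⁻¹ + (KCd + KC) * (mB ^ 2 * a⁻¹ + LINB)) +
            |h| * (KCd * QdB) + (KCd + KC) * R2B) -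
            (e * |h| * (KZ * mB ^ 2 * a⁻¹) +
              |h| * KCd * (|h| * (e * (mB ^ 2 * a⁻¹ + LINB) + R2B) + |h| * QdB) +
              KC * (|h| * (e * (mB ^ 2 * a⁻¹ + LINB) + R2B))) =
            |h| * KCd * (e * (mB ^ 2 * a⁻¹ + LINB) + R2B) * (1 - |h|) := by ring
        linarith [hdiff, hx]
    _ = _ := by
        simp only [hmB, hLINB, hR2B, hLm, hLr, hQdB]
        ring

end Helpers

end Polchinski

end Literature.Analysis.FunctionSpaces

end
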